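import Summits.KontsevichZagierPeriods.KontsevichZagierPeriods.Theorems.SoloBlindBoxGenerators
import HarnessLib

/-!
# The box sector of the Kontsevich–Zagier conjecture, III: reduction to independent unit cells

Finite generating data `D` (finitely many unit cells `ℓ(μ)`, `μ > 1`, and `a(t)`, `t > 0`, of the
formal period ring `Q`, `SoloBlindBoxGenerators`) are reduced to **`ℚ`-linearly independent**
data: choosing a maximal sub-family `u` of the `μ`'s with `ℚ`-linearly independent logarithms and
a maximal sub-family `θ` of the `t`'s with `ℚ`-linearly independent arctangents, every `ℓ(μ)`,
`μ ∈ D`, is a `K₀`-combination of the `ℓ(u_k)` and every `a(t)`, `t ∈ D`, a `K₀`-combination of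
the `a(θ_k)` **inside `Q`** — because rational relations among logarithms / arctangents of real
algebraic numbers are realised by the Kontsevich–Zagier moves
(`sum_ratCast_smul_ell_eq_zero`, `sum_ratCast_smul_alpha_eq_zero`, resting on the peeling moves
of `SoloBlindCellRelations`).  Hence `D.adjoin ≤ K₀[ℓ(u), a(θ)]` (`GenData.exists_basis`).

References: M. Kontsevich, D. Zagier, *Periods* (2001), §1.2.
-/

noncomputable section

open Set
open scoped BigOperators

namespace Summit.KontsevichZagierPeriods.KontsevichZagierPeriods.Theorems

open Literature.NumberTheory.Transcendental
open Literature.NumberTheory.Transcendental.KZ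

namespace SoloBlind

variable {κ κ' : Type}

/-- The unit-cell family `(ℓ(u_k))_k ⊔ (a(θ_k))_k` of `Q` indexed by `κ ⊕ κ'`. -/
def boxGen (u : κ → ℝ) (θ : κ' → ℝ) : κ ⊕ κ' → Q :=
  Sum.elim (fun k => ell (u k)) (fun k => alpha (θ k))

/-- `boxGen` on a logarithmic index. -/
@[simp] theorem boxGen_inl (u : κ → ℝ) (θ : κ' → ℝ) (k : κ) :
    boxGen u θ (Sum.inl k) = ell (u k) := rfl

/-- `boxGen` on an arctangent index. -/
@[simp] theorem boxGen_inr (u : κ → ℝ) (θ : κ' → ℝ) (k : κ') :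
    boxGen u θ (Sum.inr k) = alpha (θ k) := rfl

/-- The range of `boxGen u θ` is the union of the ranges of the two blocks. -/
theorem range_boxGen (u : κ → ℝ) (θ : κ' → ℝ) :
    Set.range (boxGen u θ) = Set.range (fun k => ell (u k)) ∪ Set.range (fun k => alpha (θ k)) :=
  Set.Sum.elim_range _ _

/-- **Reduction to independent unit cells.**  For every finite generating datum `D` there are
finite families `u` (real algebraic, `> 1`, with `ℚ`-linearly independent logarithms) and `θ`
(real algebraic, `> 0`, with `ℚ`-linearly independent arctangents) such that the subalgebra
generated by `D` is contained in `K₀[ℓ(u_k), a(θ_k)]`. -/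
theorem GenData.exists_basis (D : GenData) :
    ∃ (κ κ' : Type) (_ : Fintype κ) (_ : Fintype κ') (u : κ → ℝ) (θ : κ' → ℝ),
      (∀ k, IsAlgebraic ℚ (u k) ∧ 1 < u k) ∧ (∀ k, IsAlgebraic ℚ (θ k) ∧ 0 < θ k) ∧
      (LinearIndependent ℚ fun k => Real.log (u k)) ∧
      (LinearIndependent ℚ fun k => Real.arctan (θ k)) ∧
      D.adjoin ≤ Algebra.adjoin K₀ (Set.range (boxGen u θ)) := by
  classical
  obtain ⟨κ, a, ha, hspan, hli⟩ :=
    exists_linearIndependent' ℚ (fun μ : D.L => Real.log (μ : ℝ))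
  haveI : Fintype κ := Fintype.ofInjective a ha
  obtain ⟨κ', a', ha', hspan', hli'⟩ :=
    exists_linearIndependent' ℚ (fun t : D.T => Real.arctan (t : ℝ))
  haveI : Fintype κ' := Fintype.ofInjective a' ha'
  refine ⟨κ, κ', inferInstance, inferInstance, fun k => (a k : ℝ), fun k => (a' k : ℝ),
    fun k => D.hL _ (a k).2, fun k => D.hT _ (a' k).2, hli, hli', ?_⟩
  refine Algebra.adjoin_le ?_
  intro x hx
  simp only [GenData.gens, mem_union, mem_image, Finset.mem_coe] at hx
  rcases hx with ⟨μ, hμ, rfl⟩ | ⟨t, ht, rfl⟩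
  · -- `log μ` is a rational combination of the `log (a k)`, realised in `Q`
    have hmem : Real.log μ ∈
        Submodule.span ℚ (Set.range ((fun μ : D.L => Real.log (μ : ℝ)) ∘ a)) := by
      rw [hspan]
      exact Submodule.subset_span ⟨⟨μ, hμ⟩, rfl⟩
    obtain ⟨c, hc⟩ := (Submodule.mem_span_range_iff_exists_fun ℚ).mp hmem
    simp only [Function.comp_apply, Rat.smul_def] at hc
    rw [SetLike.mem_coe, ell_eq_sum_smul (D.hL μ hμ).1 (D.hL μ hμ).2 (fun k => (a k : ℝ))
      (fun k => (D.hL _ (a k).2).1) (fun k => (D.hL _ (a k).2).2) c hc]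
    refine Subalgebra.sum_mem _ fun k _ => Subalgebra.smul_mem _ ?_ _
    exact Algebra.subset_adjoin ⟨Sum.inl k, rfl⟩
  · -- `arctan t` is a rational combination of the `arctan (a' k)`, realised in `Q`
    have hmem : Real.arctan t ∈
        Submodule.span ℚ (Set.range ((fun t : D.T => Real.arctan (t : ℝ)) ∘ a')) := by
      rw [hspan']
      exact Submodule.subset_span ⟨⟨t, ht⟩, rfl⟩
    obtain ⟨c, hc⟩ := (Submodule.mem_span_range_iff_exists_fun ℚ).mp hmem
    simp only [Function.comp_apply, Rat.smul_def] at hc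
    rw [SetLike.mem_coe, alpha_eq_sum_smul (D.hT t ht).1 (D.hT t ht).2 (fun k => (a' k : ℝ))
      (fun k => (D.hT _ (a' k).2).1) (fun k => (D.hT _ (a' k).2).2) c hc]
    refine Subalgebra.sum_mem _ fun k _ => Subalgebra.smul_mem _ ?_ _
    exact Algebra.subset_adjoin ⟨Sum.inr k, rfl⟩

/-- **Every element of the box ring reduces to independent unit cells**: its class lies in
`K₀[ℓ(u_k), a(θ_k)]` for finite families `u`, `θ` as in `GenData.exists_basis`. -/
theorem exists_basis_of_mem_boxRing {z : FormalRep} (hz : z ∈ boxRing) :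
    ∃ (κ κ' : Type) (_ : Fintype κ) (_ : Fintype κ') (u : κ → ℝ) (θ : κ' → ℝ),
      (∀ k, IsAlgebraic ℚ (u k) ∧ 1 < u k) ∧ (∀ k, IsAlgebraic ℚ (θ k) ∧ 0 < θ k) ∧
      (LinearIndependent ℚ fun k => Real.log (u k)) ∧
      (LinearIndependent ℚ fun k => Real.arctan (θ k)) ∧
      mkQ z ∈ Algebra.adjoin K₀ (Set.range (boxGen u θ)) := by
  obtain ⟨D, hD⟩ := exists_genData_of_mem_boxRing hz
  obtain ⟨κ, κ', _, _, u, θ, hu, hθ, hli, hli', hle⟩ := D.exists_basis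
  exact ⟨κ, κ', inferInstance, inferInstance, u, θ, hu, hθ, hli, hli', hle hD⟩

end SoloBlind

end Summit.KontsevichZagierPeriods.KontsevichZagierPeriods.Theorems
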